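import Summits.QuantumFields.YangMills.Theorems.UnitScaleTiltProp7QH1SectorRowsOfH
import Summits.QuantumFields.YangMills.Theorems.UnitScaleTiltProp7TrueLinIterH1RowOfRegPr
import Summits.QuantumFields.YangMills.Theorems.UnitScaleTiltProp7LegLemmaQTw
import Summits.QuantumFields.YangMills.Theorems.UnitScaleTiltProp7EngOfTrueAvgBudget
import HarnessLib

/-!
# Route `UnitScaleTilt`, crux K1 «MinimiserStabilityRegPr» (stmt-QuantumFields-19200), LANE II, row (QH1)♮ — the 𝔰𝔲(2) row of the door ✓`Prop7QH1OfSectors.hQH1_of_sectors`: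
# **`h𝔰𝔲` AT THE DOOR'S `H`, FROM THE CURVED CORNER-FRAME LEGS ROW (R-LEGS) — THE `Q_k^c`-MASS OF AN 𝔰𝔲(2)-VALUED ONE-FORM IS `H¹`-BOUNDED**

Cell `ym3-torus`, width seat `ym3-torus-px21` (gen 8; claim 2026-08-29 13:14Z).  THEOREMS ONLY (0 `def`, 0 `sorry`); `--supports stmt-QuantumFields-19200 --as helper`, count-neutral.
YM₃ on T³ is a ladder rung (R3), not d = 4, not infinite volume, not the Clay problem; nothing here claims the stub, the crux, `hN06`, (QH1), (QB) or the mass gap.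
CONDITIONAL: the curved legs row `hR` (✓`Prop7RLegsOfCovGrad.rlegs_of_covGradLegs`'s conclusion; px19 g6 SIGNATURE-0 `rlegs`) is DISPLAYED, not proved.

THE POINT.  The display's `hQH1` has been traded for {`hHsplit`, `h𝔰𝔲`, `hcen`} (✓p718170); `hHsplit` holds for the door's letter `H f := c₀L·ℓ²·CURL_HS f + ‖D*_W f‖²`
(✓`Prop7QH1SectorRowsOfH.hHsplit_doorH`).  This file supplies `h𝔰𝔲` at that `H` — the `Q_k^c`-mass of a skew-adjoint traceless one-form `A` — modulo the ONE displayed analytic row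
`hR`.  MECHANISM (the mirror image of ★px19's (QB) knit, with the twisted average now on the MINORISED side): the leg lemma ✓`Prop7LegLemmaQTw.QTw_apply_eq_trueLinIter_sub_coarseGauge_T3`
writes `QTw W A c = Q (K−n) A ĉ − legs(A,c)` for the true linearised average `Q` (✓`exists_trueLinIter_family`); the AVG dictionary ✓`aQ_normSq_Qkc_toL2_eq` turns the left side into
`c₀·ℓ·Σ_c ‖QTw W A c‖_F²`; Frobenius ≤ 2·operator² (✓`sum_frob_le_two_mul_sum_normSq`) and `‖a − b‖² ≤ 2‖a‖² + 2‖b‖²` give `≤ 4c₀·(ℓΣ_ĉ‖Q A ĉ‖² + ℓΣ_c‖legs‖²)`; then ★px22's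
✓`Prop7TrueLinIterH1RowOfRegPr.trueLinIter_H1_row_of_regPr` (`ℓΣ‖Q A ĉ‖² ≤ BE·M + BE′·ℓ²·CD + BE″·e·M`) and `hR` (`Σ‖legs‖² ≤ Cr·ℓ·CD + Cr′·e·ℓ⁻¹·M`), with `M := Σ_b‖A b‖²`,
`CD := (CURL_HS + DIV_HS)_W(A)`; finally `c₀·M ≤ ‖toL2 A‖²` (✓`norm_toL2_sq`, ✓`sum_normSq_le_sum_frob`) and `H_door (toL2 A) = c₀·ℓ²·CD` (✓`doorH_toL2_eq`).
CONSTANTS (L-only): `B := 4·BE`, `B′ := 4·(BE′ + Cr)`, `B″ := 4·(BE″ + Cr′)`, `eQ := min er (min eE (10¹⁰L⁶)⁻¹)`.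

WHAT IS PROVED (ns `…Theorems.Prop7QH1SuRowOfRLegs`):
* §1 `normSq_frob_sub_le` — `‖frob(a − b)‖² ≤ 4‖a‖² + 4‖b‖²` on `M₂(ℂ)` (Frobenius vs operator norm).
* §2 ★★★ `h𝔰𝔲_doorH_of_rlegs (c₀ cB) (hR) : ⟨✓`hQH1_of_sectors`'s `h𝔰𝔲` binder at `H := H_door`⟩`.
HONEST SCOPE.  A by-name knit; `hR` displayed; the row `hcen` is not touched; nothing of [Balaban1985BackgroundPropagators] §3 beyond the cited tree theorems is asserted.
USE: `hQH1 := hQH1_of_sectors c₀ cB H_door (hH0_doorH c₀) (hHsplit_doorH c₀) (h𝔰𝔲_doorH_of_rlegs c₀ cB hR) hcen`.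

References: T. Bałaban, CMP **99** (1985) 389–434 [Balaban1985BackgroundPropagators] ((3.11) p.392, (3.13)–(3.15) p.393, Thm 3.11 p.416); CMP **98** (1985) 17–51
[Balaban1985Averaging] ((89)–(92) p.31, (124)–(127) pp.36–37); CMP **102** (1985) 277–309 [Balaban1985Variational] ((44) p.285, (51) p.286); CMP **95** (1984) 17–40
[Balaban1984PropagatorsI] ((1.18)–(1.20) pp.19–20).
-/

set_option autoImplicit false

noncomputable section

open scoped BigOperators Matrix.Norms.L2Operator Matrix InnerProductSpace ComplexConjugate

namespace Summit.QuantumFields.YangMills.Theorems.Prop7QH1SuRowOfRLegs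

open Literature.MathematicalPhysics.QuantumFieldTheory.Balaban1983to89
open Literature.MathematicalPhysics.QuantumFieldTheory.Balaban1983to89.T3ContinuumYM3Torus
open Literature.MathematicalPhysics.QuantumFieldTheory.Balaban1983to89.T3PrintedRegularMinimiser (RegPr)
open T4Continuum BlockAveraging AveragingRT ExpMeanLog BlockAveragingEMLLinearised BlockAveragingEMLLinearisedBackground BlockAveragingEMLProp2
open T3LevelShift (bondShift)
open T3PrintedRegularOrbits (sites_eq)
open B9Eq39Adjoint (curl divB)
open B10Eq27TorusAxialLog (unitsField toUField)
open B9TorusCalculus (torusT)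
open B11Eq103H1Complex (BondL2K)
open Summit.QuantumFields.YangMills.Theorems.Prop7SectET3Transport (periodsT3)
open Summit.QuantumFields.YangMills.Theorems.Prop7SectET3HilbertLetters (W₂ frobEquiv toL2 DstarL2)
open Summit.QuantumFields.YangMills.Theorems.Prop7SectET3CombLetters (Qkc)
open Summit.QuantumFields.YangMills.Theorems.Prop7SymAvgTw (frameTw QTw)
open Summit.QuantumFields.YangMills.Theorems.Prop7LegLemmaQTw (QTw_apply_eq_trueLinIter_sub_coarseGauge_T3)
open Summit.QuantumFields.YangMills.Theorems.Prop7CurvedLandauRowA (exists_trueLinIter_family)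
open Summit.QuantumFields.YangMills.Theorems.Prop7TrueLinIterH1RowOfRegPr (trueLinIter_H1_row_of_regPr)
open Summit.QuantumFields.YangMills.Theorems.Prop7EngOfTrueAvgBudget (aQ_normSq_Qkc_toL2_eq sum_normSq_le_sum_frob sum_frob_le_two_mul_sum_normSq)
open Summit.QuantumFields.YangMills.Theorems.Prop7DeltaEtaAlmostPositive (norm_toL2_sq)
open Summit.QuantumFields.YangMills.Theorems.Prop7RieszTauFrobNorm (norm_sq_frobEquiv_symm sum_norm_sq_le_two_mul_opNorm_sq)
open Summit.QuantumFields.YangMills.Theorems.Prop7QH1SectorRowsOfH (doorH_toL2_eq)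

/-! ## §1 Frobenius vs operator norm on a difference -/

/-- `‖frob(a − b)‖² ≤ 4‖a‖² + 4‖b‖²` (`‖·‖_F² ≤ 2‖·‖²_op` on `M₂(ℂ)`, then `‖a − b‖ ≤ ‖a‖ + ‖b‖`). [cite: Balaban1985Averaging, (18)–(19) p.21] -/
theorem normSq_frob_sub_le (a b : Matrix (Fin 2) (Fin 2) ℂ) :
    ‖(frobEquiv.symm (a - b) : W₂)‖ ^ 2 ≤ 4 * ‖a‖ ^ 2 + 4 * ‖b‖ ^ 2 := by
  have h1 : ‖(frobEquiv.symm (a - b) : W₂)‖ ^ 2 ≤ 2 * ‖a - b‖ ^ 2 := by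
    rw [norm_sq_frobEquiv_symm]
    exact sum_norm_sq_le_two_mul_opNorm_sq (a - b)
  have h2 : ‖a - b‖ ≤ ‖a‖ + ‖b‖ := norm_sub_le a b
  have h0 : 0 ≤ ‖a - b‖ := norm_nonneg _
  nlinarith [h1, h2, h0, norm_nonneg a, norm_nonneg b, sq_nonneg (‖a‖ - ‖b‖)]

/-! ## §2 ★★★ `h𝔰𝔲` at the door's `H`, from the curved legs row -/

variable (c₀ cB : ℕ → ℝ) [hc₀ : ∀ L : ℕ, Fact (0 < c₀ L)] [hcB : ∀ L : ℕ, Fact (0 < cB L)]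

set_option maxHeartbeats 400000 in
-- HEARTBEAT rule (README): the displayed `hR` binder, the door lambda and the leg lemma's statement are each ~15 lines of text; elaboration of the statement plus the by-name
-- instantiations measured above the default budget; kept decl-local.
/-- ★★★ **(QH1)♮-𝔰𝔲: THE 𝔰𝔲(2) ROW OF THE SECTOR DOOR AT THE DOOR'S `H`, FROM (R-LEGS).**  DISPLAYED: `hR` = the curved corner-frame legs row (✓`Prop7RLegsOfCovGrad.rlegs_of_covGradLegs`'s
conclusion VERBATIM = ★px19's K2 `hQB_of_rlegs`'s `hR`).  CONCLUSION: ✓`Prop7QH1OfSectors.hQH1_of_sectors`'s binder `h𝔰𝔲` with the letter `H` := the door lambda of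
✓`Prop7QH1SectorRowsOfH.hHsplit_doorH` (the EX letter of record), constants `(4·BE, 4·(BE′+Cr), 4·(BE″+Cr′), min er (min eE (10¹⁰L⁶)⁻¹))`.
[cite: Balaban1985BackgroundPropagators, (3.11) p.392, (3.13)–(3.15) p.393; Balaban1985Averaging, (89)–(92) p.31, (124)–(127) pp.36–37; Balaban1985Variational, (44) p.285; Balaban1984PropagatorsI, (1.18)–(1.20) pp.19–20] -/
theorem h𝔰𝔲_doorH_of_rlegs
    (hR : ∀ (L : ℕ), 1 < L → ∃ Cr Cr' er : ℝ, 0 ≤ Cr ∧ 0 ≤ Cr' ∧ 0 < er ∧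
      ∀ (F : T3Family), F.L = L → ∀ (n K : ℕ) (hnK : n < K) (e : ℝ) (W : GaugeField (F.P K) 0 (Matrix.specialUnitaryGroup (Fin 2) ℂ)),
        0 < e → e ≤ er → RegPr F n K e W → ∀ (A : PBond (F.P K) 0 → Matrix (Fin 2) (Fin 2) ℂ),
        ∑ c : PBond (F.P n) 0,
          ‖fderiv ℂ (fun A : PBond (F.P K) 0 → Matrix (Fin 2) (Fin 2) ℂ => ((frameTw F n K hnK.le W A c.src : (Matrix (Fin 2) (Fin 2) ℂ)ˣ) : Matrix (Fin 2) (Fin 2) ℂ)) 0 A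
              - ((Averaging.iter (fun i => blockAvg (P := F.P K) (j := i) (expMeanLogSU (n := Fin 2))) (K - n) W (bondShift (sites_eq F n K hnK.le) c) :
                  Matrix.specialUnitaryGroup (Fin 2) ℂ) : Matrix (Fin 2) (Fin 2) ℂ)
                * fderiv ℂ (fun A : PBond (F.P K) 0 → Matrix (Fin 2) (Fin 2) ℂ => ((frameTw F n K hnK.le W A c.tgt : (Matrix (Fin 2) (Fin 2) ℂ)ˣ) : Matrix (Fin 2) (Fin 2) ℂ)) 0 A
                * star ((Averaging.iter (fun i => blockAvg (P := F.P K) (j := i) (expMeanLogSU (n := Fin 2))) (K - n) W (bondShift (sites_eq F n K hnK.le) c) :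
                  Matrix.specialUnitaryGroup (Fin 2) ℂ) : Matrix (Fin 2) (Fin 2) ℂ)‖ ^ 2
          ≤ Cr * (F.L : ℝ) ^ (K - n) * ((∑ x : Site (F.P K) 0, ∑ μ : Fin (F.P K).d, ∑ ν : Fin (F.P K).d,
                (if μ < ν then ∑ j : Fin 2, ∑ k : Fin 2,
                  ‖(curl (torusT (F.P K) 0) (fun κ z => unitsField (toUField W) ⟨z, κ⟩) (fun κ z => A ⟨z, κ⟩) μ ν x) j k‖ ^ 2 else 0))
              + (∑ x : Site (F.P K) 0, ∑ j : Fin 2, ∑ k : Fin 2,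
                ‖(divB (torusT (F.P K) 0) (fun κ z => unitsField (toUField W) ⟨z, κ⟩) (fun κ z => A ⟨z, κ⟩) x) j k‖ ^ 2))
            + Cr' * e * ((F.L : ℝ) ^ (K - n))⁻¹ * ∑ b : PBond (F.P K) 0, ‖A b‖ ^ 2) :
    ∀ (L : ℕ), 1 < L → ∃ B B' B'' eQ : ℝ, 0 ≤ B ∧ 0 ≤ B' ∧ 0 ≤ B'' ∧ 0 < eQ ∧
      ∀ (F : T3Family), F.L = L → ∀ (n K : ℕ) (hnK : n < K) (e : ℝ) (W : GaugeField (F.P K) 0 (Matrix.specialUnitaryGroup (Fin 2) ℂ)),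
        0 < e → e ≤ eQ → RegPr F n K e W →
        ∀ A : PBond (F.P K) 0 → Matrix (Fin 2) (Fin 2) ℂ, (∀ b, A b ∈ skewAdjoint (Matrix (Fin 2) (Fin 2) ℂ)) → (∀ b, (A b).trace = 0) →
          (c₀ F.L / cB F.L) * ((F.L : ℝ) ^ (K - n)) ^ 3 * ‖Qkc F n K hnK.le (c₀ F.L) (cB F.L) W (toL2 F K (c₀ F.L) A)‖ ^ 2
            ≤ B * ‖toL2 F K (c₀ F.L) A‖ ^ 2
              + B' * (fun (F : T3Family) (n K : ℕ) (W : GaugeField (F.P K) 0 (Matrix.specialUnitaryGroup (Fin 2) ℂ)) (f : BondL2K ℂ 3 (periodsT3 F K) (c₀ F.L) W₂) =>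
                c₀ F.L * ((F.L : ℝ) ^ (K - n)) ^ 2 * (∑ x : Site (F.P K) 0, ∑ μ : Fin (F.P K).d, ∑ ν : Fin (F.P K).d,
                    (if μ < ν then ∑ j : Fin 2, ∑ k : Fin 2,
                      ‖(curl (torusT (F.P K) 0) (fun κ z => unitsField (toUField W) ⟨z, κ⟩) (fun κ z => (toL2 F K (c₀ F.L)).symm f ⟨z, κ⟩) μ ν x) j k‖ ^ 2 else 0))
                  + ‖DstarL2 F n K (c₀ F.L) W f‖ ^ 2) F n K W (toL2 F K (c₀ F.L) A)
              + B'' * e * ‖toL2 F K (c₀ F.L) A‖ ^ 2 := by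
  intro L hL
  obtain ⟨Cr, Cr', er, hCr, hCr', her, hrow⟩ := hR L hL
  obtain ⟨BE, BE', BE'', eE, hBE, hBE', hBE'', heE, hE⟩ := trueLinIter_H1_row_of_regPr L hL
  have hL0 : (0 : ℝ) < (L : ℝ) := by exact_mod_cast (lt_trans Nat.zero_lt_one hL)
  have h10 : (0 : ℝ) < (10 ^ 10 * (L : ℝ) ^ 6)⁻¹ := by positivity
  refine ⟨4 * BE, 4 * (BE' + Cr), 4 * (BE'' + Cr'), min er (min eE (10 ^ 10 * (L : ℝ) ^ 6)⁻¹), by positivity, by positivity, by positivity,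
    lt_min her (lt_min heE h10), ?_⟩
  intro F hF n K hnK e W he heQ hreg A hA htr
  -- windows
  have her' : e ≤ er := heQ.trans (min_le_left _ _)
  have heE' : e ≤ eE := heQ.trans ((min_le_right _ _).trans (min_le_left _ _))
  have hε10 : 10 ^ 10 * (F.L : ℝ) ^ 6 * e ≤ 1 := by
    have h1 : e ≤ (10 ^ 10 * (L : ℝ) ^ 6)⁻¹ := heQ.trans ((min_le_right _ _).trans (min_le_right _ _))
    rw [hF]
    have hpos : (0 : ℝ) < 10 ^ 10 * (L : ℝ) ^ 6 := by positivity
    calc 10 ^ 10 * (L : ℝ) ^ 6 * e ≤ 10 ^ 10 * (L : ℝ) ^ 6 * (10 ^ 10 * (L : ℝ) ^ 6)⁻¹ := mul_le_mul_of_nonneg_left h1 hpos.le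
      _ = 1 := mul_inv_cancel₀ hpos.ne'
  have hℓ0 : (0 : ℝ) < (F.L : ℝ) ^ (K - n) := by rw [hF]; positivity
  have hc0 : (0 : ℝ) < c₀ F.L := (hc₀ F.L).out
  -- the true linearised family and the leg identity on the 𝔰𝔲(2)-valued `A`
  obtain ⟨Q, hQ0, hQs⟩ := exists_trueLinIter_family W
  have hLeg := fun c : PBond (F.P n) 0 => QTw_apply_eq_trueLinIter_sub_coarseGauge_T3 F hnK.le he hε10 W hreg Q hQ0 hQs A hA htr c
  -- the two analytic rows
  have hQE := hE F hF n K hnK e W he heE' hreg Q hQ0 hQs A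
  have hRl := hrow F hF n K hnK e W he her' hreg A
  -- the AVG dictionary and the door's `H` on `toL2 A`
  have hAQ := aQ_normSq_Qkc_toL2_eq (F := F) hnK.le (c₀ := c₀ F.L) (cB := cB F.L) 1 W A
  rw [one_mul, one_mul] at hAQ
  rw [hAQ, doorH_toL2_eq c₀ F n K W A, norm_toL2_sq]
  -- pointwise: Frobenius of `QTw W A c = Q A ĉ − legs` against `4‖Q A ĉ‖² + 4‖legs‖²`
  have hpt : ∀ c : PBond (F.P n) 0, ‖(frobEquiv.symm (QTw F n K hnK.le W A c) : W₂)‖ ^ 2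
      ≤ 4 * ‖Q (K - n) A (bondShift (sites_eq F n K hnK.le) c)‖ ^ 2
        + 4 * ‖fderiv ℂ (fun A : PBond (F.P K) 0 → Matrix (Fin 2) (Fin 2) ℂ => ((frameTw F n K hnK.le W A c.src : (Matrix (Fin 2) (Fin 2) ℂ)ˣ) : Matrix (Fin 2) (Fin 2) ℂ)) 0 A
              - ((Averaging.iter (fun i => blockAvg (P := F.P K) (j := i) (expMeanLogSU (n := Fin 2))) (K - n) W (bondShift (sites_eq F n K hnK.le) c) :
                  Matrix.specialUnitaryGroup (Fin 2) ℂ) : Matrix (Fin 2) (Fin 2) ℂ)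
                * fderiv ℂ (fun A : PBond (F.P K) 0 → Matrix (Fin 2) (Fin 2) ℂ => ((frameTw F n K hnK.le W A c.tgt : (Matrix (Fin 2) (Fin 2) ℂ)ˣ) : Matrix (Fin 2) (Fin 2) ℂ)) 0 A
                * star ((Averaging.iter (fun i => blockAvg (P := F.P K) (j := i) (expMeanLogSU (n := Fin 2))) (K - n) W (bondShift (sites_eq F n K hnK.le) c) :
                  Matrix.specialUnitaryGroup (Fin 2) ℂ) : Matrix (Fin 2) (Fin 2) ℂ)‖ ^ 2 := by
    intro c
    rw [hLeg c]
    exact normSq_frob_sub_le _ _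
  have hsum := Finset.sum_le_sum fun c (_ : c ∈ (Finset.univ : Finset (PBond (F.P n) 0))) => hpt c
  rw [Finset.sum_add_distrib, ← Finset.mul_sum, ← Finset.mul_sum] at hsum
  -- reindex the true-average sum over the fine index set
  have hre : (∑ c : PBond (F.P n) 0, ‖Q (K - n) A (bondShift (sites_eq F n K hnK.le) c)‖ ^ 2)
      = ∑ c' : PBond (F.P K) (K - n), ‖Q (K - n) A c'‖ ^ 2 :=
    Equiv.sum_comp (bondShift (sites_eq F n K hnK.le)) (fun c' => ‖Q (K - n) A c'‖ ^ 2)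
  rw [hre] at hsum
  -- bookkeeping letters
  set ℓ : ℝ := (F.L : ℝ) ^ (K - n) with hℓ_def
  set FQ : ℝ := ∑ c : PBond (F.P n) 0, ‖(frobEquiv.symm (QTw F n K hnK.le W A c) : W₂)‖ ^ 2
  set QS : ℝ := ∑ c' : PBond (F.P K) (K - n), ‖Q (K - n) A c'‖ ^ 2
  set LG : ℝ := ∑ c : PBond (F.P n) 0,
          ‖fderiv ℂ (fun A : PBond (F.P K) 0 → Matrix (Fin 2) (Fin 2) ℂ => ((frameTw F n K hnK.le W A c.src : (Matrix (Fin 2) (Fin 2) ℂ)ˣ) : Matrix (Fin 2) (Fin 2) ℂ)) 0 A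
              - ((Averaging.iter (fun i => blockAvg (P := F.P K) (j := i) (expMeanLogSU (n := Fin 2))) (K - n) W (bondShift (sites_eq F n K hnK.le) c) :
                  Matrix.specialUnitaryGroup (Fin 2) ℂ) : Matrix (Fin 2) (Fin 2) ℂ)
                * fderiv ℂ (fun A : PBond (F.P K) 0 → Matrix (Fin 2) (Fin 2) ℂ => ((frameTw F n K hnK.le W A c.tgt : (Matrix (Fin 2) (Fin 2) ℂ)ˣ) : Matrix (Fin 2) (Fin 2) ℂ)) 0 A
                * star ((Averaging.iter (fun i => blockAvg (P := F.P K) (j := i) (expMeanLogSU (n := Fin 2))) (K - n) W (bondShift (sites_eq F n K hnK.le) c) :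
                  Matrix.specialUnitaryGroup (Fin 2) ℂ) : Matrix (Fin 2) (Fin 2) ℂ)‖ ^ 2
  set CD : ℝ := (∑ x : Site (F.P K) 0, ∑ μ : Fin (F.P K).d, ∑ ν : Fin (F.P K).d,
          (if μ < ν then ∑ j : Fin 2, ∑ k : Fin 2,
            ‖(curl (torusT (F.P K) 0) (fun κ z => unitsField (toUField W) ⟨z, κ⟩) (fun κ z => A ⟨z, κ⟩) μ ν x) j k‖ ^ 2 else 0))
        + (∑ x : Site (F.P K) 0, ∑ j : Fin 2, ∑ k : Fin 2,
          ‖(divB (torusT (F.P K) 0) (fun κ z => unitsField (toUField W) ⟨z, κ⟩) (fun κ z => A ⟨z, κ⟩) x) j k‖ ^ 2)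
  set M : ℝ := ∑ b : PBond (F.P K) 0, ‖A b‖ ^ 2
  set MF : ℝ := ∑ b : PBond (F.P K) 0, ‖(frobEquiv.symm (A b) : W₂)‖ ^ 2
  have hM : M ≤ MF := sum_normSq_le_sum_frob A
  have hM0 : 0 ≤ M := Finset.sum_nonneg fun _ _ => sq_nonneg _
  have hCD0 : 0 ≤ CD := by
    refine add_nonneg (Finset.sum_nonneg fun _ _ => Finset.sum_nonneg fun _ _ => Finset.sum_nonneg fun _ _ => ?_)
      (Finset.sum_nonneg fun _ _ => Finset.sum_nonneg fun _ _ => Finset.sum_nonneg fun _ _ => sq_nonneg _)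
    split_ifs
    · exact Finset.sum_nonneg fun _ _ => Finset.sum_nonneg fun _ _ => sq_nonneg _
    · exact le_rfl
  have hLG0 : 0 ≤ LG := Finset.sum_nonneg fun _ _ => sq_nonneg _
  -- (1) `c₀·ℓ·FQ ≤ 4c₀·(ℓ·QS) + 4c₀·(ℓ·LG)`
  have h1 : c₀ F.L * ℓ * FQ ≤ 4 * c₀ F.L * (ℓ * QS) + 4 * c₀ F.L * (ℓ * LG) := by
    have := mul_le_mul_of_nonneg_left hsum (mul_nonneg hc0.le hℓ0.le)
    linarith
  -- (2) the QE′ row times `c₀`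
  have h2 : c₀ F.L * (ℓ * QS) ≤ c₀ F.L * (BE * M + BE' * ℓ ^ 2 * CD + BE'' * e * M) := mul_le_mul_of_nonneg_left hQE hc0.le
  -- (3) the legs row times `ℓ` (and `c₀`): `ℓ·LG ≤ Cr·ℓ²·CD + Cr′·e·M`
  have h3 : c₀ F.L * (ℓ * LG) ≤ c₀ F.L * (Cr * ℓ ^ 2 * CD + Cr' * e * M) := by
    refine mul_le_mul_of_nonneg_left ?_ hc0.le
    have h := mul_le_mul_of_nonneg_left hRl hℓ0.le
    have hℓℓ : ℓ * (Cr * ℓ * CD + Cr' * e * ℓ⁻¹ * M) = Cr * ℓ ^ 2 * CD + Cr' * e * M := by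
      field_simp
    linarith [hℓℓ]
  -- (4) the masses against `‖toL2 A‖² = c₀·MF`
  have h4 : BE * (c₀ F.L * M) ≤ BE * (c₀ F.L * MF) := mul_le_mul_of_nonneg_left (mul_le_mul_of_nonneg_left hM hc0.le) hBE
  have h5 : BE'' * e * (c₀ F.L * M) ≤ BE'' * e * (c₀ F.L * MF) :=
    mul_le_mul_of_nonneg_left (mul_le_mul_of_nonneg_left hM hc0.le) (mul_nonneg hBE'' he.le)
  have h6 : Cr' * e * (c₀ F.L * M) ≤ Cr' * e * (c₀ F.L * MF) :=
    mul_le_mul_of_nonneg_left (mul_le_mul_of_nonneg_left hM hc0.le) (mul_nonneg hCr' he.le)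
  nlinarith [h1, h2, h3, h4, h5, h6, hc0.le, hCD0, hM0, hLG0, hBE, hBE', hBE'', hCr, hCr', he.le]

end Summit.QuantumFields.YangMills.Theorems.Prop7QH1SuRowOfRLegs

end
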